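import Mathlib
import HarnessLib
import Summits.ResolutionOfSingularities.ResolutionOfSingularities.Theorems.WildQuotientsWildQuotientResolutionTerminalBlowup
import Literature.AlgebraicGeometry.Resolution.BlowupsEquivariant
import Literature.AlgebraicGeometry.Resolution.AffineBlowupCartier
import Literature.AlgebraicGeometry.Resolution.IdealSheafLemmas

/-!
# Terminal blow-ups of affine `G`-schemes: the `hdiv` clause for `liftAction` on `Bl_I(Spec B)`
(crux stmt-ResolutionOfSingularities-15640 `WildQuotients.WildQuotientResolution`, line `Sketch`;
chain w45c programme «INSTANTIATE T1», stub S4-scheme of `L/w45c/CHAIN.md` v2 §4, part 2)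

[OURS · L1 W4.5c; NOT a statement of the manuscript.] Packaging of
`TerminalBlowup.isPrincipal_span_stalkAug` (`…TerminalBlowup.lean`) for affine `G`-schemes in the
format of the chain's quotient-data layer (`AffineQuotient.exists_specAction`, p466417): a group
`G` acts on a ring `B` (`MulSemiringAction`), hence on `Spec B` by `ρ g = Spec (g⁻¹)`; an ideal
`I ⊆ B` stable under `G` has a `G`-stable ideal sheaf (`idealSheaf_comap_specAction`, the
ideal-sheaf form of S2a), so the action lifts to every blow-up `π : V → Spec B` along it
(`IsBlowup.liftAction`). **`isPrincipal_stalkAug_liftAction_spec`**: if `I = (c_1, …, c_n)` with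
`g • c_j = c_j`, `g • b - b ∈ I` for all `b ∈ B`, and every `c_j ∈ ⟨g • b - b⟩` — i.e. `I` is the
augmentation ideal of `g` and is generated by `g`-invariants — then at every point `v ∈ V` fixed
by the lift of `g` the augmentation ideal of the stalk action is principal: the `hdiv` clause of
`CyclicTransfer.cyclicDivisorialTransfer` / `CyclicDivisorialModelsLE` for the pair `(V, g)`.
The stalk dictionary: the stalk action of `Spec φ` at a fixed prime sends the germ of `F` to the
germ of `φ F` (`stalkAction_germ`: `germ_stalkSpecializes`, `germ_stalkMap`,
`ΓSpecIso_inv_naturality`); the stalk of the ideal sheaf of `I` is generated by the germs of the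
`c_j` (`stalkIdeal_eq_map_germ`, `ideal_ofIdealTop_top`); "`b r - r ∈ I_s` for all germs `r`" is
checked on `B` because `𝒪_{Spec B, s}` is a localisation of `B`
(`StructureSheaf.IsLocalization.to_stalk`, `IsLocalization.ringHom_ext`). Used by programme T
(`σ = J₂ ⊕ J₂` on `𝔸⁴`, `I = (x₀, x₂)`).
-/

-- single-problem summit: the doubled namespace component `ResolutionOfSingularities` is forced
set_option linter.dupNamespace false

noncomputable section

open CategoryTheory AlgebraicGeometry TopologicalSpace IsLocalRing
open Literature.AlgebraicGeometry.Resolution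
open scoped Pointwise

namespace Summit.ResolutionOfSingularities.ResolutionOfSingularities.Theorems.WildQuotientResolution.TerminalBlowup

universe u

section SpecAction

variable {B : Type u} [CommRing B] {G : Type u} [Group G] [MulSemiringAction G B]

/-- A `G`-stable ideal is mapped onto itself by each `g`. [folklore] -/
theorem map_toRingEquiv_eq_of_stable (I : Ideal B) (hI : ∀ (g : G) (b : B), b ∈ I → g • b ∈ I)
    (g : G) : I.map ((MulSemiringAction.toRingEquiv G B g : B ≃+* B) : B →+* B) = I := by
  apply le_antisymm
  · rw [Ideal.map_le_iff_le_comap]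
    intro b hb
    exact hI g b hb
  · intro b hb
    have : b = (MulSemiringAction.toRingEquiv G B g : B ≃+* B) (g⁻¹ • b) := by
      rw [MulSemiringAction.toRingEquiv_apply_apply, smul_inv_smul]
    rw [this]
    exact Ideal.mem_map_of_mem _ (hI g⁻¹ b hb)

/-- **A `G`-stable ideal has a `G`-stable ideal sheaf** (S2a of the chain in ideal-sheaf form):
for the action `ρ g = Spec (g⁻¹)` on `Spec B` and an ideal `I` with `g • I ⊆ I` for all `g`,
`(ρ g)⁻¹ Ĩ = Ĩ` for the ideal sheaf `Ĩ = affineBlowup.idealSheaf I` — the hypothesis of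
`IsBlowup.liftAction`. (`comap_ofIdealTop_SpecMap`: the inverse image along `Spec φ` of the
ideal sheaf of `I` is that of `φ(I) B`, and `g⁻¹ I = I`.) [folklore] -/
theorem idealSheaf_comap_specAction (ρ : G →* Aut (Spec (CommRingCat.of B)))
    (hρ : ∀ g : G, (ρ g).hom =
      Spec.map (CommRingCat.ofHom ((MulSemiringAction.toRingEquiv G B g⁻¹ : B ≃+* B) : B →+* B)))
    (I : Ideal B) (hI : ∀ (g : G) (b : B), b ∈ I → g • b ∈ I) (g : G) :
    (affineBlowup.idealSheaf I).comap (ρ g).hom = affineBlowup.idealSheaf I := by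
  rw [hρ, affineBlowup.idealSheaf, comap_ofIdealTop_SpecMap, map_toRingEquiv_eq_of_stable I hI]

/-- **The stalk action of `Spec φ` at a fixed prime, on germs**: for a ring endomorphism `φ`
of `B` and a point `s` of `Spec B` fixed by `Spec φ`, the stalk action
`stalkSpecializes ≫ (Spec φ)^♯_s` sends the germ of `F ∈ B` (through `ΓSpecIso`) to the germ of
`φ F` (`germ_stalkSpecializes`, `Scheme.Hom.germ_stalkMap`, `Scheme.ΓSpecIso_inv_naturality`).
[folklore] -/
theorem stalkAction_germ (φ : B →+* B) (s : Spec (CommRingCat.of B))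
    (hs : (Spec.map (CommRingCat.ofHom φ)).base s = s) (F : B) :
    ((Spec (CommRingCat.of B)).presheaf.stalkSpecializes (specializes_of_eq hs) ≫
        (Spec.map (CommRingCat.ofHom φ)).stalkMap s).hom
      (((Spec (CommRingCat.of B)).presheaf.germ ⊤ s trivial).hom
        ((Scheme.ΓSpecIso (CommRingCat.of B)).inv.hom F)) =
    ((Spec (CommRingCat.of B)).presheaf.germ ⊤ s trivial).hom
      ((Scheme.ΓSpecIso (CommRingCat.of B)).inv.hom (φ F)) := by
  set f := Spec.map (CommRingCat.ofHom φ) with hf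
  rw [CommRingCat.comp_apply, ← CommRingCat.comp_apply ((Spec (CommRingCat.of B)).presheaf.germ ⊤ s trivial),
    TopCat.Presheaf.germ_stalkSpecializes, Scheme.Hom.germ_stalkMap_apply]
  have h1 : (f.app ⊤).hom ((Scheme.ΓSpecIso (CommRingCat.of B)).inv.hom F) =
      (Scheme.ΓSpecIso (CommRingCat.of B)).inv.hom (φ F) := by
    have h := congrArg (fun k : CommRingCat.of B ⟶ _ => k.hom F)
      (Scheme.ΓSpecIso_inv_naturality (CommRingCat.ofHom φ))
    exact h.symm
  rw [h1]
  rfl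

/-- **One blow-up of an invariantly generated augmentation ideal is terminal, affine form**
(the `hdiv` clause of `CyclicTransfer.cyclicDivisorialTransfer` for the lifted action). Let `G`
act on the ring `B`, `ρ g = Spec (g⁻¹)` the induced action on `Spec B`
(`AffineQuotient.exists_specAction`), `I ⊆ B` an ideal with `G`-stable ideal sheaf (`hJ`, e.g.
`idealSheaf_comap_specAction`), `π : V → Spec B` a blow-up along it (`IsBlowup`), and `g ∈ G`
such that `I = (c_1, …, c_n)` with `g • c_j = c_j`, `g • b - b ∈ I` for all `b`, and
`c_j ∈ ⟨g • b - b : b ∈ B⟩` for all `j`. Then at every point `v` of `V` fixed by the lift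
`(liftAction ρ) g` the ideal `⟨(stalkSpecializes ≫ (liftAction ρ g)^♯_v) y - y : y ∈ 𝒪_{V,v}⟩`
is principal. Proof: `TerminalBlowup.isPrincipal_span_stalkAug` with the germs of the `c_j` as
generators of the stalk of the centre (`stalkIdeal_eq_map_germ`, `ideal_ofIdealTop_top`); the
stalk action of `ρ g = Spec (g⁻¹)` is `g⁻¹` on germs (`stalkAction_germ`), so it fixes the germs
of the `c_j`, moves every germ within the stalk of `I` (checked on `B`, `𝒪_{Spec B,s}` being a
localisation of `B`: `IsLocalization.ringHom_ext`), and `germ c_j ∈ ⟨b r - r⟩` since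
`g • b₀ - b₀ = -(g⁻¹ • b₁ - b₁)` with `b₁ = g • b₀`. [folklore] -/
theorem isPrincipal_stalkAug_liftAction_spec (ρ : G →* Aut (Spec (CommRingCat.of B)))
    (hρ : ∀ g : G, (ρ g).hom =
      Spec.map (CommRingCat.ofHom ((MulSemiringAction.toRingEquiv G B g⁻¹ : B ≃+* B) : B →+* B)))
    (I : Ideal B) {V : Scheme.{u}} {π : V ⟶ Spec (CommRingCat.of B)}
    (hπ : IsBlowup π (affineBlowup.idealSheaf I))
    (hJ : ∀ g : G, (affineBlowup.idealSheaf I).comap (ρ g).hom = affineBlowup.idealSheaf I)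
    (g : G) {n : ℕ} (cB : Fin n → B) (hcI : Ideal.span (Set.range cB) = I)
    (hfix : ∀ j, g • cB j = cB j) (haug : ∀ b : B, g • b - b ∈ I)
    (hcmem : ∀ j, cB j ∈ Ideal.span (Set.range fun b : B => g • b - b))
    (v : V) (hv : ((hπ.liftAction ρ hJ) g).hom.base v = v) :
    (Ideal.span (Set.range fun y =>
      (V.presheaf.stalkSpecializes (specializes_of_eq hv) ≫
        ((hπ.liftAction ρ hJ) g).hom.stalkMap v).hom y - y)).IsPrincipal := by
  classical
  -- the germ map `B → 𝒪_{(Spec (CommRingCat.of B)),(π.base v)}` and the action of `g⁻¹` on `B`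
  let γ : B →+* (Spec (CommRingCat.of B)).presheaf.stalk (π.base v) :=
    ((Scheme.ΓSpecIso (CommRingCat.of B)).inv ≫ (Spec (CommRingCat.of B)).presheaf.germ ⊤ (π.base v) trivial).hom
  set φ : B →+* B := ((MulSemiringAction.toRingEquiv G B g⁻¹ : B ≃+* B) : B →+* B) with hφ
  have hφapp : ∀ b : B, φ b = g⁻¹ • b := fun b => rfl
  -- `g • b - b ∈ I` also for `g⁻¹`
  have haug' : ∀ b : B, g⁻¹ • b - b ∈ I := fun b => by
    have h := haug (g⁻¹ • b)
    rw [smul_inv_smul] at h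
    rw [← neg_sub]
    exact I.neg_mem h
  -- the stalk action of `ρ g` on germs is `g⁻¹`
  have key : ∀ (f : (Spec (CommRingCat.of B)) ⟶ (Spec (CommRingCat.of B))) (_ : f = Spec.map (CommRingCat.ofHom φ)) (hsf : f.base (π.base v) = (π.base v)) (F : B),
      ((Spec (CommRingCat.of B)).presheaf.stalkSpecializes (specializes_of_eq hsf) ≫ f.stalkMap (π.base v)).hom (γ F) = γ (φ F) := by
    intro f hf hsf F
    subst hf
    exact stalkAction_germ φ (π.base v) hsf F
  refine isPrincipal_span_stalkAug hπ (hπ.liftAction_hom_comp ρ hJ g) v hv (fun j => γ (cB j))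
    ?_ ?_
  · -- the germs of the `cB j` generate the stalk of the centre
    rw [stalkIdeal_eq_map_germ (affineBlowup.idealSheaf I) ⟨⊤, isAffineOpen_top (Spec (CommRingCat.of B))⟩ trivial]
    change _ = Ideal.map _ ((Scheme.IdealSheafData.ofIdealTop _).ideal ⟨⊤, isAffineOpen_top (Spec (CommRingCat.of B))⟩)
    rw [ideal_ofIdealTop_top, Ideal.map_map, ← hcI, Ideal.map_span, ← Set.range_comp]
    rfl
  · intro hs'
    have hbγ : ∀ F : B, ((Spec (CommRingCat.of B)).presheaf.stalkSpecializes (specializes_of_eq hs') ≫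
        (ρ g).hom.stalkMap (π.base v)).hom (γ F) = γ (g⁻¹ • F) := fun F => key _ (hρ g) hs' F
    set b : (Spec (CommRingCat.of B)).presheaf.stalk (π.base v) →+* (Spec (CommRingCat.of B)).presheaf.stalk (π.base v) :=
      ((Spec (CommRingCat.of B)).presheaf.stalkSpecializes (specializes_of_eq hs') ≫ (ρ g).hom.stalkMap (π.base v)).hom with hb
    refine ⟨fun j => ?_, fun r => ?_, fun j => ?_⟩
    · -- `b` fixes the germs of the invariant generators
      rw [hbγ, inv_smul_eq_iff.mpr (hfix j).symm]
    · -- `b r - r` lies in the stalk of the centre: check on `B` (ring maps out of a localisation)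
      letI : Algebra B ((Spec (CommRingCat.of B)).presheaf.stalk (π.base v)) := StructureSheaf.stalkAlgebra (↑(CommRingCat.of B)) (π.base v)
      haveI : IsLocalization.AtPrime ((Spec (CommRingCat.of B)).presheaf.stalk (π.base v)) (π.base v).asIdeal :=
        StructureSheaf.IsLocalization.to_stalk (↑(CommRingCat.of B)) (π.base v)
      have halg : ∀ F : B, algebraMap B ((Spec (CommRingCat.of B)).presheaf.stalk (π.base v)) F = γ F := fun F => rfl
      set Is : Ideal ((Spec (CommRingCat.of B)).presheaf.stalk (π.base v)) := Ideal.span (Set.range fun j => γ (cB j)) with hIs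
      have hIs' : Is = I.map γ := by
        rw [hIs, ← hcI, Ideal.map_span, ← Set.range_comp]
        rfl
      have hagree : (Ideal.Quotient.mk Is).comp b = Ideal.Quotient.mk Is := by
        apply IsLocalization.ringHom_ext (π.base v).asIdeal.primeCompl (S := (Spec (CommRingCat.of B)).presheaf.stalk (π.base v))
        refine RingHom.ext fun F => ?_
        simp only [RingHom.comp_apply, halg]
        rw [hbγ, Ideal.Quotient.eq, hIs']
        rw [← map_sub]
        exact Ideal.mem_map_of_mem γ (haug' F)
      have h := RingHom.congr_fun hagree r
      rw [RingHom.comp_apply, Ideal.Quotient.eq] at h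
      exact h
    · -- the germ of `cB j` is in the augmentation ideal of `b`
      have h1 : γ (cB j) ∈ (Ideal.span (Set.range fun b : B => g • b - b)).map γ :=
        Ideal.mem_map_of_mem γ (hcmem j)
      rw [Ideal.map_span] at h1
      refine Ideal.span_le.mpr ?_ h1
      rintro _ ⟨_, ⟨b₀, rfl⟩, rfl⟩
      -- `γ (g • b₀ - b₀) = -(b (γ (g • b₀)) - γ (g • b₀))`
      have h2 : γ (g • b₀ - b₀) = -(b (γ (g • b₀)) - γ (g • b₀)) := by
        rw [hb, hbγ, inv_smul_smul, map_sub, neg_sub]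
      rw [SetLike.mem_coe, h2]
      exact Submodule.neg_mem _ (Ideal.subset_span ⟨γ (g • b₀), rfl⟩)

end SpecAction

end Summit.ResolutionOfSingularities.ResolutionOfSingularities.Theorems.WildQuotientResolution.TerminalBlowup

end
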